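import Summits.Ventures.Crystal3D.Theorems.StickyWulffConstantGenericWallFloorRayAlignedWord
import HarnessLib

/-!
# The ENDS of the aligned word: a ray-aligned pair's reduced word is adjacent to the launch slots

HONEST FRAMING. Part of the venture `Summits/Ventures/Crystal3D` (cell `crystal3d-full`), helper `--supports` the
crux `GenericWallFloor` (stmt-Ventures-19480) of `route-Ventures-StickyWulffConstant`, registered line `WallLedgerG`,
open stub `stub_twoSlabAdhesion`.  Fourth file of the WORD HALF of G-CL (cf-p1 DECISION (l)): the converse of the two
criteria of `…RayAlignedCriteria`, for words of every length.

By `…RayAlignedWord`, a co-axial coincidence for the steep pair `(u₁, u₂)` writes `A₂·Λ₀ = (wordFrame A₁ (γ ++ j ++ α))·Λ₀`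
with `α` (grain 1's ray word) reduced and ending next to `u₁`, `γ` (grain 2's transported reverse ray word) reduced and
beginning next to `A₂ u₂`, `|j| ≤ 1`.  Reduction cancels only at the two junctions:

* **`exists_reduced_of_junctions`** — for reduced `γ`, `α` and `|j| ≤ 1` there is a reduced word `ρ` with the same frame,
  letters among the original ones, and `|ρ| ≤ 1 ∨ ρ.getLast? = α.getLast? (α ≠ []) ∨ ρ.head? = γ.head? (γ ≠ [])`
  (`junction_reduce` twice).
* **`ends_of_rayAlignedAt`** — if `A₂·Λ₀ = (wordFrame A₁ κ)·Λ₀` for a REDUCED admissible `κ` with `|κ| ≥ 2` and the pair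
  is ray-aligned, then for EVERY steep pair `(u₁, u₂)`: the last letter of `κ` is adjacent to `u₁`
  (`⟪u₁, κ.last⟫ = ±√(2/3)`) OR the head letter of `κ`, pushed by the far frame, is adjacent to `A₂ u₂`
  (`⟪A₂ u₂, (wordFrame A₁ κ) κ.head⟫ = ±√(2/3)`) — by the rigidity of reduced words (`map_reflection_eq_of_image_eq`).
* **`ends_of_rayAlignedAt_two`**, **`not_rayAlignedAt_of_word_two`** — the `Σ9` form: with `κ = [κ₀, κ₁]`, every steep
  pair has `⟪u₁, κ₁⟫ ≠ 0` or `⟪A₂ u₂, (wordFrame A₁ [κ₀, κ₁]) κ₀⟫ ≠ 0`; so ONE steep-up slot in the plane `κ₁` together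
  with ONE steep-down slot in the back plane puts the pair OFF the ray-aligned Core (`c₀ = 1` there by
  `genericWallFloorAt_of_not_residual`).

WHAT THIS IS NOT: not the stub; no counting; F-C1 not moved.
-/

noncomputable section

namespace Summit.Ventures.Crystal3D.Theorems

open Summit.Ventures.Crystal3D Finset
open Literature.MathematicalPhysics.StatisticalMechanics (fccStacking barlowStacking IsHaggSeq)
open scoped InnerProductSpace

/-! ### Reduction cancels only at the junctions -/

/-- One junction: for reduced menu words `γ`, `κ`, the word `γ ++ κ` has a reduced form `γ.take p ++ κ.drop q` with the
same frame. -/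
theorem exists_reduced_append (B : EuclideanSpace ℝ (Fin 3) ≃ₗᵢ[ℝ] EuclideanSpace ℝ (Fin 3))
    (γ κ : List (EuclideanSpace ℝ (Fin 3)))
    (hγl : ∀ μ ∈ γ, ‖μ‖ = 1 ∧
      ∀ w ∈ fccSlots, ⟪w, μ⟫_ℝ = 0 ∨ ⟪w, μ⟫_ℝ = Real.sqrt (2 / 3) ∨ ⟪w, μ⟫_ℝ = -Real.sqrt (2 / 3))
    (hγc : List.IsChain (fun μ μ' => ⟪μ, μ'⟫_ℝ = 1 / 3 ∨ ⟪μ, μ'⟫_ℝ = -1 / 3) γ)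
    (hκl : ∀ μ ∈ κ, ‖μ‖ = 1 ∧
      ∀ w ∈ fccSlots, ⟪w, μ⟫_ℝ = 0 ∨ ⟪w, μ⟫_ℝ = Real.sqrt (2 / 3) ∨ ⟪w, μ⟫_ℝ = -Real.sqrt (2 / 3))
    (hκc : List.IsChain (fun μ μ' => ⟪μ, μ'⟫_ℝ = 1 / 3 ∨ ⟪μ, μ'⟫_ℝ = -1 / 3) κ) :
    ∃ p q : ℕ, wordFrame B (γ ++ κ) = wordFrame B (γ.take p ++ κ.drop q) ∧
      List.IsChain (fun μ μ' => ⟪μ, μ'⟫_ℝ = 1 / 3 ∨ ⟪μ, μ'⟫_ℝ = -1 / 3) (γ.take p ++ κ.drop q) := by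
  obtain ⟨j, -, -, hwf, -, hnc⟩ := junction_reduce B γ.length γ κ rfl
  refine ⟨γ.length - j, j, hwf, ?_⟩
  have h1 : List.IsChain (fun μ μ' => ⟪μ, μ'⟫_ℝ = 1 / 3 ∨ ⟪μ, μ'⟫_ℝ = -1 / 3) (γ.take (γ.length - j)) := by
    have := hγc; rw [← List.take_append_drop (γ.length - j) γ] at this
    exact (List.isChain_append.1 this).1
  have h2 : List.IsChain (fun μ μ' => ⟪μ, μ'⟫_ℝ = 1 / 3 ∨ ⟪μ, μ'⟫_ℝ = -1 / 3) (κ.drop j) := by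
    have := hκc; rw [← List.take_append_drop j κ] at this
    exact (List.isChain_append.1 this).2.1
  rw [List.isChain_append]
  exact ⟨h1, h2, fun x hx y hy => inner_third_of_reflection_ne (hγl x (List.mem_of_mem_take (List.mem_of_getLast? hx)))
    (hκl y (List.mem_of_mem_drop (List.mem_of_head? hy))) (hnc x hx y hy)⟩

/-- **Reduction cancels only at the junctions.**  For reduced menu words `γ`, `α` and a junction `j` of at most one menu
letter, `γ ++ j ++ α` has a reduced form `ρ` with the same frame, letters among the original ones, which is short
(`|ρ| ≤ 1`) or keeps `α`'s last letter or keeps `γ`'s head letter. -/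
theorem exists_reduced_of_junctions (B : EuclideanSpace ℝ (Fin 3) ≃ₗᵢ[ℝ] EuclideanSpace ℝ (Fin 3))
    (γ j α : List (EuclideanSpace ℝ (Fin 3)))
    (hl : ∀ μ ∈ γ ++ j ++ α, ‖μ‖ = 1 ∧
      ∀ w ∈ fccSlots, ⟪w, μ⟫_ℝ = 0 ∨ ⟪w, μ⟫_ℝ = Real.sqrt (2 / 3) ∨ ⟪w, μ⟫_ℝ = -Real.sqrt (2 / 3))
    (hγc : List.IsChain (fun μ μ' => ⟪μ, μ'⟫_ℝ = 1 / 3 ∨ ⟪μ, μ'⟫_ℝ = -1 / 3) γ)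
    (hαc : List.IsChain (fun μ μ' => ⟪μ, μ'⟫_ℝ = 1 / 3 ∨ ⟪μ, μ'⟫_ℝ = -1 / 3) α) (hj : j.length ≤ 1) :
    ∃ ρ : List (EuclideanSpace ℝ (Fin 3)),
      wordFrame B (γ ++ j ++ α) = wordFrame B ρ ∧ (∀ μ ∈ ρ, μ ∈ γ ++ j ++ α) ∧
      List.IsChain (fun μ μ' => ⟪μ, μ'⟫_ℝ = 1 / 3 ∨ ⟪μ, μ'⟫_ℝ = -1 / 3) ρ ∧
      (ρ.length ≤ 1 ∨ (α ≠ [] ∧ ρ.getLast? = α.getLast?) ∨ (γ ≠ [] ∧ ρ.head? = γ.head?)) := by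
  have hγl : ∀ μ ∈ γ, ‖μ‖ = 1 ∧
      ∀ w ∈ fccSlots, ⟪w, μ⟫_ℝ = 0 ∨ ⟪w, μ⟫_ℝ = Real.sqrt (2 / 3) ∨ ⟪w, μ⟫_ℝ = -Real.sqrt (2 / 3) :=
    fun μ hμ => hl μ (by simp [hμ])
  have hjl : ∀ μ ∈ j, ‖μ‖ = 1 ∧
      ∀ w ∈ fccSlots, ⟪w, μ⟫_ℝ = 0 ∨ ⟪w, μ⟫_ℝ = Real.sqrt (2 / 3) ∨ ⟪w, μ⟫_ℝ = -Real.sqrt (2 / 3) :=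
    fun μ hμ => hl μ (by simp [hμ])
  have hαl : ∀ μ ∈ α, ‖μ‖ = 1 ∧
      ∀ w ∈ fccSlots, ⟪w, μ⟫_ℝ = 0 ∨ ⟪w, μ⟫_ℝ = Real.sqrt (2 / 3) ∨ ⟪w, μ⟫_ℝ = -Real.sqrt (2 / 3) :=
    fun μ hμ => hl μ (by simp [hμ])
  -- a junction of at most one letter is a chain
  have hjc : List.IsChain (fun μ μ' => ⟪μ, μ'⟫_ℝ = 1 / 3 ∨ ⟪μ, μ'⟫_ℝ = -1 / 3) j := by
    match j, hj with
    | [], _ => exact List.isChain_nil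
    | [x], _ => exact List.isChain_singleton x
  -- step 1: reduce `j ++ α`
  obtain ⟨p₁, q₁, hwf₁, hc₁⟩ := exists_reduced_append B j α hjl hjc hαl hαc
  set ρ₁ := j.take p₁ ++ α.drop q₁ with hρ₁
  have hρ₁l : ∀ μ ∈ ρ₁, ‖μ‖ = 1 ∧
      ∀ w ∈ fccSlots, ⟪w, μ⟫_ℝ = 0 ∨ ⟪w, μ⟫_ℝ = Real.sqrt (2 / 3) ∨ ⟪w, μ⟫_ℝ = -Real.sqrt (2 / 3) := by
    intro μ hμ
    rcases List.mem_append.1 hμ with h | h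
    · exact hjl μ (List.mem_of_mem_take h)
    · exact hαl μ (List.mem_of_mem_drop h)
  -- step 2: reduce `γ ++ ρ₁`
  obtain ⟨p, q₂, hwf₂, hc₂⟩ := exists_reduced_append B γ ρ₁ hγl hγc hρ₁l hc₁
  refine ⟨γ.take p ++ ρ₁.drop q₂, ?_, fun μ hμ => ?_, hc₂, ?_⟩
  · rw [← hwf₂, wordFrame_append B γ ρ₁, ← hwf₁, ← wordFrame_append, List.append_assoc]
  · rcases List.mem_append.1 hμ with h | h
    · exact List.mem_append.2 (Or.inl (List.mem_append.2 (Or.inl (List.mem_of_mem_take h))))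
    · have h' := List.mem_of_mem_drop h
      rcases List.mem_append.1 h' with h'' | h''
      · exact List.mem_append.2 (Or.inl (List.mem_append.2 (Or.inr (List.mem_of_mem_take h''))))
      · exact List.mem_append.2 (Or.inr (List.mem_of_mem_drop h''))
  · -- the surviving ends
    -- `ρ₁.drop q₂ = (j.take p₁).drop q₂ ++ α.drop (q₁ + (q₂ - (j.take p₁).length))`
    have hsplit : ρ₁.drop q₂ = (j.take p₁).drop q₂ ++ α.drop (q₁ + (q₂ - (j.take p₁).length)) := by
      rw [hρ₁, List.drop_append, List.drop_drop]
    by_cases hα : q₁ + (q₂ - (j.take p₁).length) < α.length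
    · -- `α`'s last letter survives
      right; left
      have hne : α.drop (q₁ + (q₂ - (j.take p₁).length)) ≠ [] := by
        rw [Ne, List.drop_eq_nil_iff]; omega
      have hαne : α ≠ [] := by rintro rfl; simp at hα
      refine ⟨hαne, ?_⟩
      rw [hsplit, ← List.append_assoc, List.getLast?_append_of_ne_nil _ hne, List.getLast?_drop]
      rw [if_neg (by omega)]
    · -- `α` is consumed: `ρ = γ.take p ++ (j.take p₁).drop q₂`
      have hαnil : α.drop (q₁ + (q₂ - (j.take p₁).length)) = [] := by
        rw [List.drop_eq_nil_iff]; omega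
      have hjs : ((j.take p₁).drop q₂).length ≤ 1 := by
        rw [List.length_drop, List.length_take]; omega
      by_cases hp : p = 0 ∨ γ = []
      · left
        have hγt : γ.take p = [] := by
          rcases hp with rfl | rfl
          · rw [List.take_zero]
          · rw [List.take_nil]
        rw [hγt, List.nil_append, hsplit, hαnil, List.append_nil]; exact hjs
      · right; right
        push Not at hp
        refine ⟨hp.2, ?_⟩
        have hγt : γ.take p ≠ [] := by
          rw [Ne, List.take_eq_nil_iff]; exact not_or.2 ⟨hp.1, hp.2⟩
        rw [List.head?_append_of_ne_nil _ hγt, List.head?_take, if_neg hp.1]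

/-! ### The ends of the aligned word -/

/-- Letters with the same mirror are equal up to sign, so their inner products with any vector agree up to sign. -/
theorem inner_eq_or_eq_neg_of_reflection_eq {x y : EuclideanSpace ℝ (Fin 3)} (hx : ‖x‖ = 1) (hy : ‖y‖ = 1)
    (h : (ℝ ∙ x)ᗮ.reflection = (ℝ ∙ y)ᗮ.reflection) (v : EuclideanSpace ℝ (Fin 3)) :
    ⟪v, x⟫_ℝ = ⟪v, y⟫_ℝ ∨ ⟪v, x⟫_ℝ = -⟪v, y⟫_ℝ := by
  rcases eq_or_eq_neg_of_reflection_eq hx hy h with h' | h'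
  · exact Or.inl (by rw [h'])
  · exact Or.inr (by rw [h', inner_neg_right])

/-- **The ends of the aligned word.**  If `A₂·Λ₀ = (wordFrame A₁ κ)·Λ₀` for a reduced admissible word `κ` with `|κ| ≥ 2`
and the pair is ray-aligned, then for every steep pair `(u₁, u₂)` the LAST letter of `κ` is adjacent to `u₁` or the HEAD
letter of `κ`, pushed by the far frame, is adjacent to `A₂ u₂`. -/
theorem ends_of_rayAlignedAt {A₁ A₂ : EuclideanSpace ℝ (Fin 3) ≃ₗᵢ[ℝ] EuclideanSpace ℝ (Fin 3)}
    {κ : List (EuclideanSpace ℝ (Fin 3))}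
    (hκl : ∀ μ ∈ κ, ‖μ‖ = 1 ∧
      ∀ w ∈ fccSlots, ⟪w, μ⟫_ℝ = 0 ∨ ⟪w, μ⟫_ℝ = Real.sqrt (2 / 3) ∨ ⟪w, μ⟫_ℝ = -Real.sqrt (2 / 3))
    (hκc : List.IsChain (fun μ μ' => ⟪μ, μ'⟫_ℝ = 1 / 3 ∨ ⟪μ, μ'⟫_ℝ = -1 / 3) κ) (hκ2 : 2 ≤ κ.length)
    (hA₂ : A₂ '' fccStacking 1 (Real.sqrt (2 / 3)) = (wordFrame A₁ κ) '' fccStacking 1 (Real.sqrt (2 / 3)))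
    (hray : RayAlignedAt A₁ A₂) {u₁ u₂ : EuclideanSpace ℝ (Fin 3)} (hu₁ : u₁ ∈ fccSlots)
    (hs₁ : Real.sqrt 2 / 2 ≤ ⟪A₁ u₁, EuclideanSpace.single (2 : Fin 3) (1 : ℝ)⟫_ℝ) (hu₂ : u₂ ∈ fccSlots)
    (hs₂ : ⟪A₂ u₂, EuclideanSpace.single (2 : Fin 3) (1 : ℝ)⟫_ℝ ≤ -(Real.sqrt 2 / 2)) :
    (∃ μ, κ.getLast? = some μ ∧ (⟪u₁, μ⟫_ℝ = Real.sqrt (2 / 3) ∨ ⟪u₁, μ⟫_ℝ = -Real.sqrt (2 / 3))) ∨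
    (∃ μ, κ.head? = some μ ∧
      (⟪A₂ u₂, wordFrame A₁ κ μ⟫_ℝ = Real.sqrt (2 / 3) ∨ ⟪A₂ u₂, wordFrame A₁ κ μ⟫_ℝ = -Real.sqrt (2 / 3))) := by
  obtain ⟨γ, j, α, -, hl, hαc, hγc, hj, hαlast, hγhead, himg⟩ := exists_word_of_rayAlignedAt hray hu₁ hs₁ hu₂ hs₂
  obtain ⟨ρ, hwf, hsub, hρc, hends⟩ := exists_reduced_of_junctions A₁ γ j α hl hγc hαc hj
  have hρl : ∀ μ ∈ ρ, ‖μ‖ = 1 ∧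
      ∀ w ∈ fccSlots, ⟪w, μ⟫_ℝ = 0 ∨ ⟪w, μ⟫_ℝ = Real.sqrt (2 / 3) ∨ ⟪w, μ⟫_ℝ = -Real.sqrt (2 / 3) :=
    fun μ hμ => hl μ (hsub μ hμ)
  -- rigidity: `κ` and `ρ` have the same mirrors, hence the same frame
  have himgs : (wordFrame A₁ κ : EuclideanSpace ℝ (Fin 3) → EuclideanSpace ℝ (Fin 3)) '' ↑fccSlots =
      (wordFrame A₁ ρ : EuclideanSpace ℝ (Fin 3) → EuclideanSpace ℝ (Fin 3)) '' ↑fccSlots :=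
    image_fccSlots_eq_of_image_fcc_eq _ _ (by rw [← hA₂, himg, hwf])
  have hmap := map_reflection_eq_of_image_eq A₁ hκl hκc hρl hρc himgs
  have hfr : wordFrame A₁ κ = wordFrame A₁ (γ ++ j ++ α) := by rw [hwf]; exact wordFrame_eq_of_map_eq A₁ hmap
  have hlen : ρ.length = κ.length := by
    have := congrArg List.length hmap; rw [List.length_map, List.length_map] at this; exact this.symm
  rcases hends with h1 | ⟨hαne, hlast⟩ | ⟨hγne, hhead⟩
  · omega
  · -- `α`'s last letter survives: it is adjacent to `u₁`
    left
    rcases hαlast with rfl | ⟨μ₀, hμ₀, hμ₀u⟩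
    · exact absurd rfl hαne
    · have hκne : κ ≠ [] := by rintro rfl; simp at hκ2
      obtain ⟨x, hx⟩ := Option.ne_none_iff_exists'.1 (mt List.getLast?_eq_none_iff.1 hκne)
      refine ⟨x, hx, ?_⟩
      have h1 := congrArg List.getLast? hmap
      rw [List.getLast?_map, List.getLast?_map, hx, hlast, hμ₀, Option.map_some, Option.map_some,
        Option.some.injEq] at h1
      have hx1 := (hκl x (List.mem_of_getLast? hx)).1
      have hμ1 := (hl μ₀ (by simp [List.mem_of_getLast? hμ₀])).1
      rcases inner_eq_or_eq_neg_of_reflection_eq hx1 hμ1 h1 u₁ with h | h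
      · exact Or.inl (by rw [h, hμ₀u])
      · exact Or.inr (by rw [h, hμ₀u])
  · -- `γ`'s head letter survives: pushed by the far frame it is adjacent to `A₂ u₂`
    right
    rcases hγhead with rfl | ⟨μ₀, hμ₀, hμ₀u⟩
    · exact absurd rfl hγne
    · have hκne : κ ≠ [] := by rintro rfl; simp at hκ2
      obtain ⟨x, hx⟩ := Option.ne_none_iff_exists'.1 (mt List.head?_eq_none_iff.1 hκne)
      refine ⟨x, hx, ?_⟩
      have h1 := congrArg List.head? hmap
      rw [List.head?_map, List.head?_map, hx, hhead, hμ₀, Option.map_some, Option.map_some,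
        Option.some.injEq] at h1
      have hx1 := (hκl x (List.mem_of_head? hx)).1
      have hμ1 := (hl μ₀ (by simp [List.mem_of_head? hμ₀])).1
      rw [hfr]
      rcases eq_or_eq_neg_of_reflection_eq hx1 hμ1 h1 with h | h
      · exact Or.inl (by rw [h, hμ₀u])
      · exact Or.inr (by rw [h, map_neg, inner_neg_right, hμ₀u])

/-- **The `Σ9` form.**  `A₂·Λ₀ = (wordFrame A₁ [κ₀, κ₁])·Λ₀` (reduced: `⟪κ₀, κ₁⟫ = ±1/3`) and ray-aligned ⇒ every steep
pair has `u₁` adjacent to the first plane `κ₁` or `A₂ u₂` adjacent to the back plane `(wordFrame A₁ [κ₀, κ₁]) κ₀`. -/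
theorem ends_of_rayAlignedAt_two {A₁ A₂ : EuclideanSpace ℝ (Fin 3) ≃ₗᵢ[ℝ] EuclideanSpace ℝ (Fin 3)}
    {κ₀ κ₁ : EuclideanSpace ℝ (Fin 3)}
    (hκ₀ : ‖κ₀‖ = 1 ∧ ∀ w ∈ fccSlots, ⟪w, κ₀⟫_ℝ = 0 ∨ ⟪w, κ₀⟫_ℝ = Real.sqrt (2 / 3) ∨ ⟪w, κ₀⟫_ℝ = -Real.sqrt (2 / 3))
    (hκ₁ : ‖κ₁‖ = 1 ∧ ∀ w ∈ fccSlots, ⟪w, κ₁⟫_ℝ = 0 ∨ ⟪w, κ₁⟫_ℝ = Real.sqrt (2 / 3) ∨ ⟪w, κ₁⟫_ℝ = -Real.sqrt (2 / 3))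
    (hκc : ⟪κ₀, κ₁⟫_ℝ = 1 / 3 ∨ ⟪κ₀, κ₁⟫_ℝ = -1 / 3)
    (hA₂ : A₂ '' fccStacking 1 (Real.sqrt (2 / 3)) = (wordFrame A₁ [κ₀, κ₁]) '' fccStacking 1 (Real.sqrt (2 / 3)))
    (hray : RayAlignedAt A₁ A₂) {u₁ u₂ : EuclideanSpace ℝ (Fin 3)} (hu₁ : u₁ ∈ fccSlots)
    (hs₁ : Real.sqrt 2 / 2 ≤ ⟪A₁ u₁, EuclideanSpace.single (2 : Fin 3) (1 : ℝ)⟫_ℝ) (hu₂ : u₂ ∈ fccSlots)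
    (hs₂ : ⟪A₂ u₂, EuclideanSpace.single (2 : Fin 3) (1 : ℝ)⟫_ℝ ≤ -(Real.sqrt 2 / 2)) :
    ⟪u₁, κ₁⟫_ℝ ≠ 0 ∨ ⟪A₂ u₂, wordFrame A₁ [κ₀, κ₁] κ₀⟫_ℝ ≠ 0 := by
  have hr : Real.sqrt (2 / 3) ≠ 0 := (Real.sqrt_pos.2 (by norm_num)).ne'
  have hκl : ∀ μ ∈ [κ₀, κ₁], ‖μ‖ = 1 ∧
      ∀ w ∈ fccSlots, ⟪w, μ⟫_ℝ = 0 ∨ ⟪w, μ⟫_ℝ = Real.sqrt (2 / 3) ∨ ⟪w, μ⟫_ℝ = -Real.sqrt (2 / 3) := by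
    intro μ hμ
    simp only [List.mem_cons, List.mem_nil_iff, or_false] at hμ
    rcases hμ with rfl | rfl
    · exact hκ₀
    · exact hκ₁
  have hκc' : List.IsChain (fun μ μ' => ⟪μ, μ'⟫_ℝ = 1 / 3 ∨ ⟪μ, μ'⟫_ℝ = -1 / 3) [κ₀, κ₁] :=
    List.isChain_cons.2 ⟨fun b hb => by
      rw [List.head?_cons, Option.mem_some_iff] at hb; rw [← hb]; exact hκc, List.isChain_singleton κ₁⟩
  rcases ends_of_rayAlignedAt hκl hκc' (by simp) hA₂ hray hu₁ hs₁ hu₂ hs₂ with ⟨μ, hμ, h⟩ | ⟨μ, hμ, h⟩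
  · left
    have : μ = κ₁ := by simpa using hμ.symm
    subst this
    rcases h with h | h <;> rw [h] <;> [exact hr; exact neg_ne_zero.2 hr]
  · right
    have : μ = κ₀ := by simpa using hμ.symm
    subst this
    rcases h with h | h <;> rw [h] <;> [exact hr; exact neg_ne_zero.2 hr]

/-- **Off the Core by two slots.**  A `Σ9`-related pair with ONE steep-up slot in the first plane and ONE steep-down slot
in the back plane is not ray-aligned. -/
theorem not_rayAlignedAt_of_word_two {A₁ A₂ : EuclideanSpace ℝ (Fin 3) ≃ₗᵢ[ℝ] EuclideanSpace ℝ (Fin 3)}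
    {κ₀ κ₁ : EuclideanSpace ℝ (Fin 3)}
    (hκ₀ : ‖κ₀‖ = 1 ∧ ∀ w ∈ fccSlots, ⟪w, κ₀⟫_ℝ = 0 ∨ ⟪w, κ₀⟫_ℝ = Real.sqrt (2 / 3) ∨ ⟪w, κ₀⟫_ℝ = -Real.sqrt (2 / 3))
    (hκ₁ : ‖κ₁‖ = 1 ∧ ∀ w ∈ fccSlots, ⟪w, κ₁⟫_ℝ = 0 ∨ ⟪w, κ₁⟫_ℝ = Real.sqrt (2 / 3) ∨ ⟪w, κ₁⟫_ℝ = -Real.sqrt (2 / 3))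
    (hκc : ⟪κ₀, κ₁⟫_ℝ = 1 / 3 ∨ ⟪κ₀, κ₁⟫_ℝ = -1 / 3)
    (hA₂ : A₂ '' fccStacking 1 (Real.sqrt (2 / 3)) = (wordFrame A₁ [κ₀, κ₁]) '' fccStacking 1 (Real.sqrt (2 / 3)))
    {u₁ u₂ : EuclideanSpace ℝ (Fin 3)} (hu₁ : u₁ ∈ fccSlots)
    (hs₁ : Real.sqrt 2 / 2 ≤ ⟪A₁ u₁, EuclideanSpace.single (2 : Fin 3) (1 : ℝ)⟫_ℝ) (hin₁ : ⟪u₁, κ₁⟫_ℝ = 0)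
    (hu₂ : u₂ ∈ fccSlots) (hs₂ : ⟪A₂ u₂, EuclideanSpace.single (2 : Fin 3) (1 : ℝ)⟫_ℝ ≤ -(Real.sqrt 2 / 2))
    (hin₂ : ⟪A₂ u₂, wordFrame A₁ [κ₀, κ₁] κ₀⟫_ℝ = 0) :
    ¬ RayAlignedAt A₁ A₂ := fun hray => by
  rcases ends_of_rayAlignedAt_two hκ₀ hκ₁ hκc hA₂ hray hu₁ hs₁ hu₂ hs₂ with h | h
  · exact h hin₁
  · exact h hin₂

end Summit.Ventures.Crystal3D.Theorems

end
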